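import Summits.BirchSwinnertonDyer.BirchSwinnertonDyer.Theorems.UniversalToricDescentSurjLeafOfInclusionAndEisenstein
import Summits.BirchSwinnertonDyer.BirchSwinnertonDyer.Theorems.SemiOrdinaryEisensteinDescentEisensteinKernelAtThreeRestrictedOfFrameOdd
import Summits.BirchSwinnertonDyer.BirchSwinnertonDyer.Theorems.SemiOrdinaryEisensteinDescentWildSplitEisensteinInclusionAtThreeRestrictedOfCTL
import Summits.BirchSwinnertonDyer.BirchSwinnertonDyer.Theorems.UniversalToricDescentWildSplitFrameAtThreeOddOfPrintOfEngine
import Summits.BirchSwinnertonDyer.BirchSwinnertonDyer.Theorems.UniversalToricDescentWildSplitControlAtThreeOfPoitouTate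
import HarnessLib

/-!
# The CROSS-ROUTE kernel «UTD's inclusion S + SOED's Eisenstein half ⟹ the onto wild rank-one leaf», RE-KEYED to the cruxes
# of record: E′ (SOED 24155, restricted) for E (20479, aside), the `R₀`-frame at odd `d_K` (UTD 24475, CLOSED) + LZZ for the
# value crux V (20385, aside), Poitou–Tate PT1 ∧ PT2 for the control crux C (20386, aside) — and its T = 0 SHADOW: over S the
# leaf needs from route SOED exactly the restricted value-at-𝟙 residual `E_𝟙′`
# (cell `pub/bsd-wall`, width seat `bsd-wall-soed-p1-w3` g7, `--supports stmt-BirchSwinnertonDyer-24155`, helper)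

WHY. utd-p3 g2's `Theorems/UniversalToricDescentSurjLeafOfInclusionAndEisenstein.lean` §2
(`WildThreeInclusionKernel.wAllExclAddWildRankOneSurj_of_inclusion_of_eisenstein`) is the cross-route kernel
`ToricPublishedInputs → S (UTD 20395) → E (SOED 20479) → V (20385) → C (20386) → Z (20387) → WAllExclAddWildRankOneSurj` — no
twin, no Kolyvagin system, no `3`-adic tower. Since then E, V, C went ASIDE on their routes (SOED revs 6–14, UTD revs 27/28):
SOED's crux of record is the RESTRICTED E′ `WildSplitEisensteinInclusionAtThreeRestricted` (24155); V is consumed once as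
«one `R₀`-frame at odd `d_K` + LZZ» (UTD support 24475 `WildSplitFrameAtThreeOddOfPrint`, CLOSED·proved, + soed-p1-w3 g6's
`EisensteinKernelAtThreeRestrictedOfFrameOdd.exists_unit_hasValueAt_of_frame`); C is a theorem modulo PT1 ∧ PT2 (utd-p3 g5's
`UniversalToricDescentControl.wildSplitControlAtThree_of_poitouTate`). That kernel consumed E only at the Friedberg–Hoffstein
datum (`L(E^(d_K),1) ≠ 0`, `P = y_K` non-torsion — E′'s extra binders in hand) and V only at that field, where `d_K` is ODD
(`2` split). This file forwards those data; nothing else changes. Then, by soed-p1-w3 g6's p597052 §3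
(`E′ ⟸ {Kolyvagin, S, E_𝟙′, PT1}`), the SOED input collapses to its T = 0 shadow `E_𝟙′`.

CONTENTS (0 definitions, 0 named facts, 0 `sorry`; every crux / fact is an ANTECEDENT):
* §1 `indexUpperBoundLeAt_of_inclusion_of_frame_of_control` — utd-p3 g2's §1 (upper index socket at one datum from S) with V
  replaced by {LZZ, an `R₀`-frame supply at this curve and field}.
* §2 `wAllExclAddWildRankOneSurj_of_inclusion_of_restricted_of_frameOdd_of_control` — the kernel:
  `ToricPublishedInputs → S → E′ → LZZ → [24475's conclusion, displayed] → C → Z → leaf`. Proof = utd-p3 g2's §2 verbatim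
  except: frame from the displayed supplier at the FH field (odd `d_K`), unit value by `exists_unit_hasValueAt_of_frame`,
  Eisenstein step fed by E′ with the datum, upper socket by §1.
* §3 BY-NAME corollaries: `…_of_print_of_poitouTate` — `ToricPublishedInputs → S → E′ → LZZ → Hsieh A → BDP13 → PT1 → PT2 →
  Z → leaf` (24475 and C discharged by name); **`wAllExclAddWildRankOneSurj_of_inclusion_of_valueAtOneRestricted_of_print_of_poitouTate`
  — `ToricPublishedInputs → S → E_𝟙′ → LZZ → Hsieh A → BDP13 → PT1 → PT2 → Z → leaf`**: over UTD's wall S the onto wild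
  rank-one leaf needs from SOED ONLY `E_𝟙′` (`ord₃ f(𝟙) ≥ ord₃ 𝓛(𝟙)` for a characteristic generator `f` at the datum's
  frames) — no Ko′/J′ (24696/24702), no tower, no V/C cruxes.

HONEST FRAMING: CONDITIONAL on two OPEN research cruxes (S = UTD 20395, E′/`E_𝟙′` = SOED 24155's content; walls documented in
`Cruxes/WildSplitEisensteinInclusionAtThree/Lines/birth-dead*.md`), on the open rank-zero wild leaf Z, and on print named
facts (LZZ, Hsieh 2014 Thm A, BDP 2013, Poitou–Tate ×2, ToricPublishedInputs); theorems only; closes nothing; BSD₃ for no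
curve.

References: [JetchevSkinnerWan2017] §7.4.1, Thm. 3.3.1 (arXiv:1512.06894 pp. 11, 30); [Castella2018] Thm. 2.3, §5; [GrossZagier1986]
I.(6.3), V §2; [FriedbergHoffstein1995] Thm. B; [LiuZhangZhang2018] Thm 1.5.1/1.5.3; [Hsieh2014] Thm. A; [BertoliniDarmonPrasanna2013]
Thm. 5.13; [MilneADT2006] I Thm. 4.10; [Kolyvagin1990] Thm. A.
-/

noncomputable section

open scoped Classical

set_option linter.dupNamespace false -- `Summit.BirchSwinnertonDyer.BirchSwinnertonDyer.Theorems.…` (summit = sub, D-0017)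
set_option autoImplicit false

namespace Summit.BirchSwinnertonDyer.BirchSwinnertonDyer.Theorems.WildThreeInclusionKernelRestricted

open WeierstrassCurve NumberField IsDedekindDomain Field
  Literature.NumberTheory.EllipticCurves
  Literature.NumberTheory.EllipticCurves.ModularForms
  Literature.NumberTheory.EllipticCurves.LiuZhangZhang2018
  Literature.NumberTheory.EllipticCurves.Rank1Residual
  Literature.NumberTheory.EllipticCurves.KrizLi2019
  Literature.NumberTheory.GaloisCohomology
  Summit.BirchSwinnertonDyer.Rank1Residual
  Summit.BirchSwinnertonDyer.Rank1Residual.Additive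
  Summit.BirchSwinnertonDyer.Rank1Residual.X11b
  Summit.BirchSwinnertonDyer.Rank1Residual.X11b.AcSelmer
  Summit.BirchSwinnertonDyer.Rank1Residual.X11b.Halves
  Summit.BirchSwinnertonDyer.BirchSwinnertonDyer.Theses
  Summit.BirchSwinnertonDyer.BirchSwinnertonDyer.Theorems.WildThreeInclusionKernel
  Summit.BirchSwinnertonDyer.BirchSwinnertonDyer.Theorems.EisensteinKernelAtThreeRestrictedOfFrameOdd
  Summit.BirchSwinnertonDyer.BirchSwinnertonDyer.Theorems.WildSplitEisensteinInclusionAtThreeRestrictedOfCTL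
  Summit.BirchSwinnertonDyer.BirchSwinnertonDyer.Theorems.UniversalToricDescentControl

/-! ### §1 The upper index socket at one Heegner datum from S, an `R₀`-frame supply and LZZ (V not needed as a crux) -/

/-- **co-STEP L at Manin slack `v₃(c)` from UTD's inclusion crux S at ONE Heegner datum, the value clause supplied by {LZZ, an
`R₀`-frame}.** utd-p3 g2's `indexUpperBoundLeAt_of_additiveSplitIMCInclusionAtThree` VERBATIM with its antecedent V
(`WildSplitWaldspurgerAtThree`, 20385, aside) replaced by: LZZ's `thm151_thm153_modularCurve_heegnerVector_additive` (`hL`) and an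
`R₀`-frame supply at every frame `(κ, γ, 𝔭)` of THIS curve at THIS field (`hFr`, the shape of UTD 24475's conclusion at one
`(W, N, K, Dt)`); the unit value is then `exists_unit_hasValueAt_of_frame` (soed-p1-w3 g6, p594734 §1). Conclusion:
`Upper.IndexUpperBoundLeAt W 3 K P (v₃ c)`. CONDITIONAL; closes nothing.
[cite: JetchevSkinnerWan2017, §7.4.1 (arXiv:1512.06894 p. 30)] [cite: Castella2018, Thm. 2.3 and §5 (5.1)–(5.3)]
[cite: LiuZhangZhang2018, Thm 1.5.1 and Thm 1.5.3 (Duke Math. J. 167 pp. 748–749)] -/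
theorem indexUpperBoundLeAt_of_inclusion_of_frame_of_control
    (hKo : ∀ (N : ℕ) [NeZero N] (W : WeierstrassCurve ℚ) (K : Type) [Field K] [NumberField K],
      kolyvagin N W K)
    (hI : UniversalToricDescent.AdditiveSplitIMCInclusionAtThree)
    (hL : thm151_thm153_modularCurve_heegnerVector_additive)
    (hC : UniversalToricDescent.WildSplitControlAtThree)
    (W : WeierstrassCurve ℚ) [W.IsElliptic] [W.IsGloballyMinimal] (N : ℕ) [NeZero N]
    (K : Type) [Field K] [NumberField K] (Dt : ModularParametrizationData W N)
    (H : HeegnerDatum N (NumberField.discr K)) (ι : K →+* ℂ) (P : (W.baseChange K).toAffine.Point)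
    (hO6 : ClassO6 W 3) (hsurj : W.HasSurjectiveModNGaloisRep 3) (hr : W.analyticRank = 1)
    (hN : W.conductorNorm ℤ = N) (hK : IsImaginaryQuadratic K) (hHN : SatisfiesHeegnerHypothesis N K)
    (hLt : (W.quadraticTwist (NumberField.discr K : ℚ)).entireLFunction 1 ≠ 0)
    (hP : WeierstrassCurve.Affine.Point.map ι.toRatAlgHom P = heegnerPointComplex Dt H)
    (hnt : ¬ IsOfFinAddOrder P)
    (hFr : ∀ (κ : ZpExtension K 3), κ.IsAnticyclotomic → ∀ (γ : Field.absoluteGaloisGroup K) [Fact (κ.IsTopGenerator γ)]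
      (𝔭 : HeightOneSpectrum (𝓞 K)), ((3 : ℕ) : 𝓞 K) ∈ 𝔭.asIdeal →
      ∃ ι' : PadicAlgCl 3 ≃+* ℂ, SchneiderFree.BranchInducesPrime 3 ι' 𝔭 ∧
        ∃ (ΩK : ℂ) (Ωp : ℂ_[3]) (L : UnrSeries 3), ΩK ≠ 0 ∧ Ωp ≠ 0 ∧ IsBDPLFunction ι' 𝔭 κ γ Dt.f ΩK Ωp L) :
    SchneiderFree.Upper.IndexUpperBoundLeAt W 3 K P (padicValNat 3 Dt.c.natAbs) := by
  subst hN
  -- Kolyvagin: `rank E(K) = 1`, `Ш(E/K)` finite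
  obtain ⟨hrk, hfin⟩ := hKo (W.conductorNorm ℤ) W K hK hHN ⟨Dt, H, ι, hP⟩ hnt
  -- `3 ∣ N(E)` (additive) splits in `K`
  have h3N : 3 ∣ W.conductorNorm ℤ :=
    (W.dvd_conductorNorm_iff_not_hasGoodReductionAtPrime 3).mpr (not_good_of_addv W 3 hO6.2.1)
  have hsplit : SplitsIn K 3 := hHN 3 Nat.prime_three h3N
  -- a frame `(κ, γ, 𝔭)` and the other prime `𝔭′ ≠ 𝔭` above `3`
  obtain ⟨κ, γ, -, hκ, hγ, -⟩ := X11b.exists_anticyclotomic_generator_prime (p := 3) hK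
  haveI : Fact (κ.IsTopGenerator γ) := ⟨hγ⟩
  obtain ⟨𝔭, h𝔭, he, hf⟩ := X11b.exists_degreeOnePrime_of_splitsIn K 3 hK.1 hsplit
  obtain ⟨𝔭', hne, h𝔭', he', hf'⟩ := X11b.Three.exists_ne_degreeOne_prime hK.1 h𝔭 he hf
  -- an `R₀`-frame at `(κ, γ, 𝔭)` (displayed supplier) and its unit value at `𝟙` (LZZ)
  obtain ⟨ι', hind, ΩK, Ωp, L, hΩK, hΩp, hBDP⟩ := hFr κ hκ γ 𝔭 h𝔭
  obtain ⟨u, hval⟩ := exists_unit_hasValueAt_of_frame hL W (W.conductorNorm ℤ) K Dt H ι P hO6 rfl hK hHN hP hnt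
    κ hκ γ 𝔭 h𝔭 he hf ι' hind hΩK hΩp hBDP
  -- control count at `𝔭′` (CTL₀ included)
  have hctl : SchneiderFree.AdditiveControlOnTreeAt 3 κ 𝔭' γ (embAt K 3 𝔭' h𝔭' he' hf') P :=
    hC W (W.conductorNorm ℤ) K Dt H ι P hO6 hsurj hr rfl hK hHN hLt hP hnt (hKo _ W K) κ hκ γ 𝔭'
      h𝔭' he' hf'
  obtain ⟨n, hn, hneq⟩ := hctl
  -- THE INCLUSION `(L) ⊆ Ch_Λ(X_(∅,0) strict at 𝔭′)·R₀⟦T⟧` at the frame (UTD's crux S, by name)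
  have hincl : Ideal.span {L} ≤
      (XAc.charIdeal (W.baseChange K) 3 κ 𝔭' ∅ γ).map (PowerSeries.map (toUnr 3)) :=
    hI W (W.conductorNorm ℤ) K Dt hO6 hsurj hr rfl hK hHN κ hκ γ 𝔭 h𝔭 he hf 𝔭' h𝔭' hne ι' hind
      ΩK Ωp L hΩK hΩp hBDP
  -- the value read through the logarithm at `𝔭′` (rank one)
  have hval' : L.HasValueAt 0 ((((u : unrIntegers 3) : unrIntegers 3) : ℂ_[3]) *
      (algebraMap ℚ_[3] ℂ_[3]
        (logOmega W 3 (embAt K 3 𝔭' h𝔭' he' hf') P / (Dt.c : ℚ_[3]))) ^ 2) :=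
    (SchneiderFreeAdditiveX3.hasValueAt_sq_logOmega_embAt_iff_of_rank_one W 3 hK.1 hrk h𝔭 he hf
      h𝔭' he' hf' P _ _ L).mpr hval
  -- the UPPER socket at slack `v₃(c)`, then the link
  have hc0 : Dt.c ≠ 0 := Dt.maninConstant_ne_zero_holds
  have hlog : logOmega W 3 (embAt K 3 𝔭' h𝔭' he' hf') P ≠ 0 := X11b.R1.logOmega_ne_zero W 3 _ hnt
  have hup : SchneiderFree.Upper.AdditiveIMCUpperBDPOnTreeLeAt 3 κ 𝔭' γ (embAt K 3 𝔭' h𝔭' he' hf')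
      (padicValNat 3 Dt.c.natAbs) P :=
    SchneiderFree.Upper.additiveIMCUpperBDPOnTreeLeAt_of_value_of_dvd' hn hincl u hc0 hlog hval'
  exact SchneiderFree.Upper.indexUpperBoundLeAt_of_imcUpperLe_of_control rfl hK hHN hfin hup ⟨n, hn, hneq⟩

/-! ### §2 The cross-route kernel, re-keyed: S + E′ + {LZZ, frame at odd `d_K`} + C + Z ⟹ the leaf -/

/-- **CROSS-ROUTE KERNEL at the wild split prime `3`, cruxes of record: `ToricPublishedInputs → S (UTD 20395) →
E′ (SOED 24155) → LZZ → [UTD 24475's conclusion: an R₀-frame at every Heegner field with odd d_K] → C (20386) → Z (20387) →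
WAllExclAddWildRankOneSurj`.** utd-p3 g2's `wAllExclAddWildRankOneSurj_of_inclusion_of_eisenstein` with E ↦ E′ (the Eisenstein
step is taken at the Friedberg–Hoffstein datum, where `L(E^(d_K),1) ≠ 0` and the non-torsion Heegner point are in hand) and
V ↦ {LZZ, the displayed frame supplier `hFr`} (the FH field has `2` split, so `d_K` is odd). NO twin, NO Kolyvagin-system
input, NO `3`-adic tower. CONDITIONAL on every antecedent; closes nothing. [cite: JetchevSkinnerWan2017, §7.4.1 (arXiv:1512.06894 p. 30)]
[cite: Castella2018, Thm. 2.3 and §5 (5.1)–(5.3)] [cite: GrossZagier1986, Thm. I.(6.3) and V.§2] [cite: FriedbergHoffstein1995, Thm. B] -/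
theorem wAllExclAddWildRankOneSurj_of_inclusion_of_restricted_of_frameOdd_of_control
    (hF : UniversalToricDescent.ToricPublishedInputs)
    (hI : UniversalToricDescent.AdditiveSplitIMCInclusionAtThree)
    (hE : SemiOrdinaryEisensteinDescent.WildSplitEisensteinInclusionAtThreeRestricted)
    (hL : thm151_thm153_modularCurve_heegnerVector_additive)
    (hFr : ∀ (W : WeierstrassCurve ℚ) [W.IsElliptic] [W.IsGloballyMinimal] (N : ℕ) [NeZero N] (K : Type) [Field K]
      [NumberField K] (Dt : ModularParametrizationData W N), ClassO6 W 3 → W.conductorNorm ℤ = N → IsImaginaryQuadratic K →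
      SatisfiesHeegnerHypothesis N K → Odd (NumberField.discr K) → ∀ (κ : ZpExtension K 3), κ.IsAnticyclotomic →
      ∀ (γ : Field.absoluteGaloisGroup K) [Fact (κ.IsTopGenerator γ)] (𝔭 : HeightOneSpectrum (𝓞 K)),
        ((3 : ℕ) : 𝓞 K) ∈ 𝔭.asIdeal → ∃ ι' : PadicAlgCl 3 ≃+* ℂ, SchneiderFree.BranchInducesPrime 3 ι' 𝔭 ∧
          ∃ (ΩK : ℂ) (Ωp : ℂ_[3]) (L : UnrSeries 3), ΩK ≠ 0 ∧ Ωp ≠ 0 ∧ IsBDPLFunction ι' 𝔭 κ γ Dt.f ΩK Ωp L)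
    (hC : UniversalToricDescent.WildSplitControlAtThree)
    (hZ : UniversalToricDescent.WildRankZeroTwistAtThree) :
    Summit.BirchSwinnertonDyer.WAllExclAddWildRankOneSurj := by
  unfold Summit.BirchSwinnertonDyer.WAllExclAddWildRankOneSurj
  intro W _ _ _hncm hO6 hsurj hr
  obtain ⟨hGZ, hKo, hGZK, hmod, hmodP, -, hGZ73, hFH, hpar, hHP⟩ := hF
  haveI hN0 : NeZero (W.conductorNorm ℤ) := ⟨W.conductorNorm_pos_holds.ne'⟩
  -- (a) DATA. parity: `r_an = 1` is odd, so `w(E) = -1`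
  have hw : W.rootNumber = -1 := by
    rcases W.rootNumber_eq_one_or with h | h
    · exfalso
      have heven : Even W.analyticRank := (hpar W).mpr h
      rw [hr] at heven
      exact Nat.not_even_one heven
    · exact h
  -- Friedberg–Hoffstein with auxiliary modulus `2`: Heegner for `N(E)` and `2` split, so `d_K` odd
  obtain ⟨K, _, _, hK, -, hHN, hH2, hLt⟩ := hFH W hw 2 two_ne_zero 0
  have hodd : Odd (NumberField.discr K) := by
    have h8 := Literature.SatisfiesHeegnerHypothesis.discr_emod_eight hK.1 hH2 (dvd_refl 2)
    rw [Int.odd_iff]; omega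
  -- `3 ∣ N(E)` (additive) splits in `K`
  have h3N : 3 ∣ W.conductorNorm ℤ :=
    (W.dvd_conductorNorm_iff_not_hasGoodReductionAtPrime 3).mpr (not_good_of_addv W 3 hO6.2.1)
  have hsplit : SplitsIn K 3 := hHN 3 Nat.prime_three h3N
  -- the Heegner point over `K` and its data; non-torsion by Gross–Zagier
  obtain ⟨P, Dt, H, ι, hP⟩ := hHP W K hK hHN
  have hL0 : W.entireLFunction 1 = 0 := entireLFunction_one_eq_zero_of_analyticRank_eq_one hr
  obtain ⟨-, hderiv⟩ := leadingLCoeff_eq_deriv_of_analyticRank_eq_one hr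
  have hLK : LDerivEK W K ≠ 0 := by
    rw [lDerivEK_eq_deriv_mul W K hmod hL0]; exact mul_ne_zero hderiv hLt
  have hnt : ¬ IsOfFinAddOrder P :=
    (lDerivEK_ne_zero_iff_not_isOfFinAddOrder W (W.conductorNorm ℤ) K (hGZ _ W K) hK hHN
      ⟨Dt, H, ι, hP⟩).mp hLK
  -- Kolyvagin: `rank E(K) = 1`, `Ш(E/K)` finite
  obtain ⟨hrk, hfin⟩ := hKo (W.conductorNorm ℤ) W K hK hHN ⟨Dt, H, ι, hP⟩ hnt
  -- a frame `(κ, γ, 𝔭)` and the other prime `𝔭′ ≠ 𝔭` above `3`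
  obtain ⟨κ, γ, -, hκ, hγ, -⟩ := X11b.exists_anticyclotomic_generator_prime (p := 3) hK
  haveI : Fact (κ.IsTopGenerator γ) := ⟨hγ⟩
  obtain ⟨𝔭, h𝔭, he, hf⟩ := X11b.exists_degreeOnePrime_of_splitsIn K 3 hK.1 hsplit
  obtain ⟨𝔭', hne, h𝔭', he', hf'⟩ := X11b.Three.exists_ne_degreeOne_prime hK.1 h𝔭 he hf
  -- (b) PLUMBING. `R₀`-frame at `(κ, γ, 𝔭)` from the displayed supplier (odd `d_K`), unit value by LZZ
  obtain ⟨ι', hind, ΩK, Ωp, L, hΩK, hΩp, hBDP⟩ :=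
    hFr W (W.conductorNorm ℤ) K Dt hO6 rfl hK hHN hodd κ hκ γ 𝔭 h𝔭
  obtain ⟨u, hval⟩ := exists_unit_hasValueAt_of_frame hL W (W.conductorNorm ℤ) K Dt H ι P hO6 rfl hK hHN hP hnt
    κ hκ γ 𝔭 h𝔭 he hf ι' hind hΩK hΩp hBDP
  -- control count at `𝔭′` (CTL₀ included; supplies the torsion guard of the Eisenstein crux)
  have hctl : SchneiderFree.AdditiveControlOnTreeAt 3 κ 𝔭' γ (embAt K 3 𝔭' h𝔭' he' hf') P :=
    hC W (W.conductorNorm ℤ) K Dt H ι P hO6 hsurj hr rfl hK hHN hLt hP hnt (hKo _ W K) κ hκ γ 𝔭'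
      h𝔭' he' hf'
  obtain ⟨n, hn, hneq⟩ := hctl
  -- the RESTRICTED EISENSTEIN INCLUSION `Ch_Λ(X_(∅,0))·R₀⟦T⟧ ⊆ (L)` at the datum's frame (SOED's crux E′, torsion-guarded)
  have hincl : (XAc.charIdeal (W.baseChange K) 3 κ 𝔭' ∅ γ).map (PowerSeries.map (toUnr 3)) ≤
      Ideal.span {L} :=
    hE W (W.conductorNorm ℤ) K Dt H ι P hO6 hsurj hr rfl hK hHN hLt hP hnt κ hκ γ 𝔭 h𝔭 he hf 𝔭' h𝔭' hne
      ι' hind ΩK Ωp L hΩK hΩp hBDP hn.1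
  -- the value read through the logarithm at `𝔭′` (rank one: `(log_{𝔭′} P)² = (log_𝔭 P)²`)
  have hval' : L.HasValueAt 0 ((((u : unrIntegers 3) : unrIntegers 3) : ℂ_[3]) *
      (algebraMap ℚ_[3] ℂ_[3]
        (logOmega W 3 (embAt K 3 𝔭' h𝔭' he' hf') P / (Dt.c : ℚ_[3]))) ^ 2) :=
    (SchneiderFreeAdditiveX3.hasValueAt_sq_logOmega_embAt_iff_of_rank_one W 3 hK.1 hrk h𝔭 he hf
      h𝔭' he' hf' P _ _ L).mpr hval
  -- the LOWER socket at slack `v₃(c)` at the frame `(κ, 𝔭′, γ, embAt 𝔭′)`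
  have hc0 : Dt.c ≠ 0 := Dt.maninConstant_ne_zero_holds
  have hlog : logOmega W 3 (embAt K 3 𝔭' h𝔭' he' hf') P ≠ 0 := X11b.R1.logOmega_ne_zero W 3 _ hnt
  have hlow : SchneiderFree.AdditiveIMCLowerBDPOnTreeLeAt 3 κ 𝔭' γ (embAt K 3 𝔭' h𝔭' he' hf')
      (padicValNat 3 Dt.c.natAbs) P := by
    obtain ⟨htors, f, hfI, hf0, hfn⟩ := hn
    have hmem : PowerSeries.map (toUnr 3) f ∈ Ideal.span {L} := by
      have h3 := hincl
      rw [hfI, CongruenceLimit.map_span_singleton_powerSeries] at h3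
      exact (Ideal.span_singleton_le_iff_mem _).mp h3
    obtain ⟨-, hle⟩ := Supersingular.two_mul_valuation_le_of_mem_span 3 hf0 hmem u hval'
    have hc0' : (Dt.c : ℚ_[3]) ≠ 0 := by exact_mod_cast hc0
    rw [div_eq_mul_inv, Padic.valuation_mul hlog (inv_ne_zero hc0'), Padic.valuation_inv,
      Padic.valuation_intCast, valuation_logOmega hlog, hfn] at hle
    refine ⟨n, ⟨htors, f, hfI, hf0, hfn⟩, ?_⟩
    simp only [padicValInt] at hle
    linarith
  have hlo : SchneiderFree.IndexLowerBoundLeAt W 3 K P (padicValNat 3 Dt.c.natAbs) :=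
    SchneiderFreeAdditiveX3.indexLowerBoundLeAt_of_imcLowerLe_of_control rfl hK hHN hfin hlow
      ⟨n, hn, hneq⟩
  -- the UPPER socket at slack `v₃(c)` from S (§1; its own frame, same field)
  have hupI : SchneiderFree.Upper.IndexUpperBoundLeAt W 3 K P (padicValNat 3 Dt.c.natAbs) :=
    indexUpperBoundLeAt_of_inclusion_of_frame_of_control hKo hI hL hC W (W.conductorNorm ℤ) K Dt H ι P
      hO6 hsurj hr rfl hK hHN hLt hP hnt
      (fun κ hκ γ _ 𝔭 h𝔭 ↦ hFr W (W.conductorNorm ℤ) K Dt hO6 rfl hK hHN hodd κ hκ γ 𝔭 h𝔭)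
  -- (c) TERMINAL STEP: a globally minimal model of the twist, then p528981
  have hD0 : (NumberField.discr K : ℚ) ≠ 0 := by exact_mod_cast NumberField.discr_ne_zero K
  haveI : (W.quadraticTwist (NumberField.discr K : ℚ)).IsElliptic := W.isElliptic_quadraticTwist hD0
  obtain ⟨Cd, hCd⟩ := hasGlobalMinimalModel_rat_holds (W.quadraticTwist (NumberField.discr K : ℚ))
  haveI : (Cd • W.quadraticTwist (NumberField.discr K : ℚ)).IsGloballyMinimal := hCd
  exact SchneiderFree.Exact.bsdp_three_of_exactIndexManin_of_wAllExclAddWildRankZero hGZ hKo hGZK hmod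
    hGZ73 hZ W hO6 hsurj hr (W.conductorNorm ℤ) K Dt H ι P
    (Cd • W.quadraticTwist (NumberField.discr K : ℚ)) rfl hK hodd hHN hLt hP ⟨Cd, rfl⟩ hlo hupI

/-! ### §3 By name: 24475 (closed) and C (modulo PT1 ∧ PT2) discharged; the SOED input cut to `E_𝟙′` -/

/-- **`ToricPublishedInputs → S → E′ → LZZ → Hsieh A → BDP13 → PT1 → PT2 → Z → WAllExclAddWildRankOneSurj`.** §2 with the frame
supplier := UTD's CLOSED item 24475 (`Theorems.wildSplitFrameAtThreeOddOfPrint_proof`, modulo its print antecedents Hsieh 2014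
Thm A / BDP 2013, displayed) and C := `UniversalToricDescentControl.wildSplitControlAtThree_of_poitouTate` (PT1 ∧ PT2; its other
five inputs are tree theorems). CONDITIONAL; closes nothing. [cite: JetchevSkinnerWan2017, §7.4.1 and Thm. 3.3.1 (arXiv:1512.06894)]
[cite: Hsieh2014, Thm. A] [cite: BertoliniDarmonPrasanna2013, Thm. 5.13] [cite: MilneADT2006, Ch. I, Thm. 4.10] -/
theorem wAllExclAddWildRankOneSurj_of_inclusion_of_restricted_of_print_of_poitouTate
    (hF : UniversalToricDescent.ToricPublishedInputs)
    (hI : UniversalToricDescent.AdditiveSplitIMCInclusionAtThree)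
    (hE : SemiOrdinaryEisensteinDescent.WildSplitEisensteinInclusionAtThreeRestricted)
    (hL : thm151_thm153_modularCurve_heegnerVector_additive)
    (hHsieh : Hsieh2014.thmA_exists_isHsiehLFunction_unrPeriod_anyLevel)
    (hBDP : bertoliniDarmonPrasanna2013_centralValue_reciprocity)
    (hPT : ∀ (K : Type) [Field K] [NumberField K], poitouTate_selmerStructure_duality K)
    (hPT2 : ∀ (K : Type) [Field K] [NumberField K], poitouTate_sha_tateDual K)
    (hZ : UniversalToricDescent.WildRankZeroTwistAtThree) :
    Summit.BirchSwinnertonDyer.WAllExclAddWildRankOneSurj :=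
  wAllExclAddWildRankOneSurj_of_inclusion_of_restricted_of_frameOdd_of_control hF hI hE hL
    (wildSplitFrameAtThreeOddOfPrint_proof hHsieh hBDP) (wildSplitControlAtThree_of_poitouTate hPT hPT2) hZ

/-- **THE T = 0 SHADOW. `ToricPublishedInputs → S → E_𝟙′ → LZZ → Hsieh A → BDP13 → PT1 → PT2 → Z → WAllExclAddWildRankOneSurj`:
over UTD's wall S (`AdditiveSplitIMCInclusionAtThree`, 20395) the onto wild rank-one leaf needs from route SOED exactly the
RESTRICTED VALUE-AT-𝟙 RESIDUAL `E_𝟙′` (`hE1`, displayed in p588074's shape: at every frame of every Heegner datum of the cell with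
`L(E^(d_K),1) ≠ 0`, non-torsion `y_K` and `X_(∅,0)` torsion, every characteristic generator `f` has `|f(𝟙)|₃ ≤ |𝓛(𝟙)|₃`).**
E′ is recovered from {Kolyvagin (a conjunct of `ToricPublishedInputs`), S, `E_𝟙′`, PT1} by soed-p1-w3 g6's p597052 §3
(`restricted_of_kolyvaginInclusion_of_valueAtOneRestricted_of_poitouTate`), then the previous theorem. No Ko′/J′ (24696/24702),
no `3`-adic tower, no V/C cruxes. CONDITIONAL on the two research inputs S and `E_𝟙′`, on Z and on print; closes nothing; BSD₃
for no curve. [cite: JetchevSkinnerWan2017, Thm. 3.3.1 and §7.4.1 (arXiv:1512.06894 pp. 11, 30)] [cite: MilneADT2006, Ch. I, Thm. 4.10(b)] -/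
theorem wAllExclAddWildRankOneSurj_of_inclusion_of_valueAtOneRestricted_of_print_of_poitouTate
    (hF : UniversalToricDescent.ToricPublishedInputs)
    (hI : UniversalToricDescent.AdditiveSplitIMCInclusionAtThree)
    (hE1 : ∀ (W : WeierstrassCurve ℚ) [W.IsElliptic] [W.IsGloballyMinimal] (N : ℕ) [NeZero N] (K : Type) [Field K] [NumberField K] (Dt : Literature.NumberTheory.EllipticCurves.ModularForms.ModularParametrizationData W N) (H : Literature.NumberTheory.EllipticCurves.HeegnerDatum N (NumberField.discr K)) (ι : K →+* ℂ) (P : (W.baseChange K).toAffine.Point), Summit.BirchSwinnertonDyer.Rank1Residual.Additive.ClassO6 W 3 → W.HasSurjectiveModNGaloisRep 3 → W.analyticRank = 1 → W.conductorNorm ℤ = N → Literature.NumberTheory.EllipticCurves.IsImaginaryQuadratic K → Literature.NumberTheory.EllipticCurves.SatisfiesHeegnerHypothesis N K → (W.quadraticTwist (NumberField.discr K : ℚ)).entireLFunction 1 ≠ 0 → (WeierstrassCurve.Affine.Point.map ι.toRatAlgHom) P = Literature.NumberTheory.EllipticCurves.ModularForms.heegnerPointComplex Dt H → ¬ IsOfFinAddOrder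 P → ∀ (κ : Literature.NumberTheory.EllipticCurves.ZpExtension K 3), κ.IsAnticyclotomic → ∀ (γ : Field.absoluteGaloisGroup K) [Fact (κ.IsTopGenerator γ)] (𝔭 : IsDedekindDomain.HeightOneSpectrum (NumberField.RingOfIntegers K)), ((3 : ℕ) : NumberField.RingOfIntegers K) ∈ 𝔭.asIdeal → 𝔭.asIdeal.ramificationIdx (NumberField.RingOfIntegers ℚ) = 1 → 𝔭.asIdeal.inertiaDeg (NumberField.RingOfIntegers ℚ) = 1 → ∀ (𝔭' : IsDedekindDomain.HeightOneSpectrum (NumberField.RingOfIntegers K)), ((3 : ℕ) : NumberField.RingOfIntegers K) ∈ 𝔭'.asIdeal → 𝔭' ≠ 𝔭 → ∀ (ι' : PadicAlgCl 3 ≃+* ℂ), Summit.BirchSwinnertonDyer.BirchSwinnertonDyer.Theorems.SchneiderFree.BranchInducesPrime 3 ι' 𝔭 → ∀ (ΩK : ℂ) (Ωp : ℂ_[3]) (L : Literature.NumberTheory.EllipticCurves.UnrSeries 3), ΩK ≠ 0 → Ωp ≠ 0 → Literature.NumberTheory.EllipticCurves.IsBDPLFunction ι' 𝔭 κ γ Dt.f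 ΩK Ωp L → Module.IsTorsion (Literature.NumberTheory.EllipticCurves.IwasawaAlgebra 3) (Summit.BirchSwinnertonDyer.Rank1Residual.X11b.AcSelmer.XAc (W.baseChange K) 3 κ 𝔭' ∅ γ) → ∀ (f : Literature.NumberTheory.EllipticCurves.IwasawaAlgebra 3), Summit.BirchSwinnertonDyer.Rank1Residual.X11b.AcSelmer.XAc.charIdeal (W.baseChange K) 3 κ 𝔭' ∅ γ = Ideal.span {f} → ‖((PowerSeries.constantCoeff f : ℤ_[3]) : ℚ_[3])‖ ≤ ‖((PowerSeries.constantCoeff L : Literature.NumberTheory.EllipticCurves.unrIntegers 3) : ℂ_[3])‖)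
    (hL : thm151_thm153_modularCurve_heegnerVector_additive)
    (hHsieh : Hsieh2014.thmA_exists_isHsiehLFunction_unrPeriod_anyLevel)
    (hBDP : bertoliniDarmonPrasanna2013_centralValue_reciprocity)
    (hPT : ∀ (K : Type) [Field K] [NumberField K], poitouTate_selmerStructure_duality K)
    (hPT2 : ∀ (K : Type) [Field K] [NumberField K], poitouTate_sha_tateDual K)
    (hZ : UniversalToricDescent.WildRankZeroTwistAtThree) :
    Summit.BirchSwinnertonDyer.WAllExclAddWildRankOneSurj :=
  wAllExclAddWildRankOneSurj_of_inclusion_of_restricted_of_print_of_poitouTate hF hI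
    (restricted_of_kolyvaginInclusion_of_valueAtOneRestricted_of_poitouTate hF.2.1 hI hE1 hPT)
    hL hHsieh hBDP hPT hPT2 hZ

end Summit.BirchSwinnertonDyer.BirchSwinnertonDyer.Theorems.WildThreeInclusionKernelRestricted

end
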